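import Literature.Geometry.Lorentzian.TangencyMaximumPrinciple
import Literature.Geometry.Lorentzian.AtlasChartMetric
import Literature.Geometry.Lorentzian.MinimalGraphSymbol
import Literature.Geometry.Lorentzian.ChartMetricCoord
import Literature.Geometry.Lorentzian.CoordinateFrames
import Literature.Geometry.Lorentzian.SecondFundamentalFormApply
import Literature.Geometry.Lorentzian.CurvatureRegularity
import Literature.Geometry.Lorentzian.CurveThroughVelocity
import Literature.Geometry.Lorentzian.HypersurfaceRestriction
import Literature.Geometry.Lorentzian.MeanCurvatureRegularity
import HarnessLib

/-!
# The minimal-graph operator of a chart vanishes on minimal graphs: discharge of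
# `minimalGraph_strongMaximumPrinciple` (Andersson–Galloway–Howard 1998, Thm. 3.10)
(family `gr`, in support of **gr.S09**; namespace `Literature.Geometry.Lorentzian`)

`TangencyMaximumPrinciple.lean` reduced the named fact
`Literature.Geometry.Lorentzian.minimalGraph_strongMaximumPrinciple` (the geometric maximum
principle for two minimal graphs, Andersson–Galloway–Howard, Comm. Pure Appl. Math. 51 (1998),
Thm. 3.10 with `H₀ = 0`) to the existence, for every chart `ψ` of the maximal atlas of every
Riemannian `3`-manifold `(X, h)` and every straightening `T : E3 ≃ ℝ² × ℝ`, of a minimal-graph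
operator `MinimalGraphOperator h ψ T` (`minimalGraph_strongMaximumPrinciple_of_minimalGraphOperator`):
a `C¹` elliptic function `Φ` of second-order jets vanishing on the jets of every `C²` function
whose graph in the chart is an open piece of a smoothly embedded minimal surface
(Fontenele–Silva, Illinois J. Math. 45 (2001), §3, Lemma 3.1, Props. 3.2, 3.4, with the chart
inverse in place of `exp_p`). `MinimalGraphSymbol.lean` constructed the candidate
`Φ = MinimalGraph.operator T G'` from the components `G' = AtlasChart.metricRepr` of the metric in
the chart (`AtlasChartMetric.lean`) and proved it `C^∞` and elliptic on the jets based in the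
chart. This file proves the remaining field `eq_zero` — **the mean curvature of a graph, computed
in the chart, is `∓Φ` of its jet** — and assembles the discharge:

* `PseudoRiemannianMetric.normalDerivAlong_eq_leviCivita_of_eventuallyEq` — `D_v ν = ∇_{df v} Y`
  whenever the normal field `ν` is, near `y`, the restriction of a vector field `Y`
  (O'Neill 1983, Ch. 3, Prop. 3.18 (3), `covariantDerivAlong_comp_holds`, and locality);
* `eq_smul_of_unit_normals` — two unit normals of a hyperplane in a positive definite space
  agree up to sign (dimension count);
* the graph computation (`MinimalGraphHolds.*`): inside `W₀` the surface is
  `f = ψ⁻¹ ∘ Gr_u ∘ φ` with `φ = (T ∘ ψ ∘ f).1` a local diffeomorphism and `Gr_u x = T⁻¹(x, u x)`;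
  its differential is `dΨ ∘ A_{∇u} ∘ dφ`, its unit normal is `± dΨ N(∇u, u, ·)` with a locally
  constant sign, `D_v ν` is computed by `AtlasChart.leviCivita_mpullback_chart`, and the second and
  first fundamental forms in the basis `dφ⁻¹ eᵢ` are `± K̃(eᵢ, eⱼ)` and `γ̃(eᵢ, eⱼ)`; hence
  `H = tr_γ K = ∓ Φ(jet2 u x)` (`PseudoRiemannianMetric.trace_eq_sum_gram_inv`) and `H = 0`
  forces `Φ(jet2 u x) = 0`;
* `minimalGraphOperator h ψ T hψ : MinimalGraphOperator h ψ T` and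
  **`minimalGraph_strongMaximumPrinciple_holds`**, together with the discharges of the barrier
  principle and of the boundary maximum principle for minimal surfaces down the existing chain.

## References

* L. Andersson, G. J. Galloway, R. Howard, *A strong maximum principle for weak solutions of
  quasi-linear elliptic equations with applications to Lorentzian and Riemannian geometry*,
  Comm. Pure Appl. Math. 51 (1998) 581–624, §3.1 and Thm. 3.10.
* F. Fontenele, S. L. Silva, *A tangency principle and applications*, Illinois J. Math. 45 (2001)
  213–228, §3 (Lemma 3.1, (3.1)–(3.5), Props. 3.2, 3.4) and §4.
* B. O'Neill, *Semi-Riemannian geometry with applications to relativity*, Academic Press 1983,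
  Ch. 3, Prop. 3.18; Ch. 4, Lemma 4.1, Lemma 4.4 ff., p. 111 ff.
-/

noncomputable section

-- instance search on the nested operator spaces `E3 →L[ℝ] E3 →L[ℝ] E3 →L[ℝ] ℝ`
set_option maxSynthPendingDepth 3

open Bundle Set Function Filter VectorField TopologicalSpace Manifold Module
open scoped Manifold ContDiff Topology Matrix

namespace Literature.Geometry.Lorentzian

/-! ### `D_v ν` from an extension of the normal field -/

namespace PseudoRiemannianMetric

variable {E : Type*} [NormedAddCommGroup E] [NormedSpace ℝ E] {H : Type*} [TopologicalSpace H]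
  {I : ModelWithCorners ℝ E H} {M : Type*} [TopologicalSpace M] [ChartedSpace H M]
  [IsManifold I ∞ M] [FiniteDimensional ℝ E] {n : ℕ∞ω}
  {E' : Type*} [NormedAddCommGroup E'] [NormedSpace ℝ E'] {H' : Type*} [TopologicalSpace H']
  {I' : ModelWithCorners ℝ E' H'} {N : Type*} [TopologicalSpace N] [ChartedSpace H' N]
  [IsManifold I' ∞ N]
  (g : PseudoRiemannianMetric I n E (TangentSpace I : M → Type _)) [g.HasLeviCivita]

/-- **`D_v ν = ∇_{df v} Y` when the normal field is the restriction of a vector field.** Let `ν`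
be a field along `f : N → M`, `y` an interior point at which `f` is differentiable, and `Y` a
vector field on `M`, differentiable at `f y`, with `ν = Y ∘ f` on a neighbourhood of `y`. Then the
covariant derivative of `ν` in the direction `v ∈ T_y N` is `∇_{df_y v} Y`: the lifts of
`t ↦ ν (c t)` and `t ↦ Y (f (c t))` along the chart-straight curve `c` of velocity `v` agree near
`t = 0` (locality, `covariantDerivAlong_congr_of_eventuallyEq`), and
`D(Y ∘ γ)/dt = ∇_{γ'} Y` (O'Neill 1983, Ch. 3, Prop. 3.18 (3), `covariantDerivAlong_comp_holds`)
with `γ' (0) = df_y v`. [cite: ONeill1983, Ch. 3, Prop. 3.18 (3)] -/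
theorem normalDerivAlong_eq_leviCivita_of_eventuallyEq {f : N → M} {ν : NormalField I f}
    {Y : Π x : M, TangentSpace I x} {y : N} (hy : I'.IsInteriorPoint y)
    (hf : MDifferentiableAt I' I f y)
    (hY : MDifferentiableAt I I.tangent
      (fun x ↦ (TotalSpace.mk' E x (Y x) : TangentBundle I M)) (f y))
    (hν : ∀ᶠ y' in 𝓝 y, ν y' = Y (f y')) (v : TangentSpace I' y) :
    g.normalDerivAlong f ν y v = g.leviCivita Y (f y) (mfderiv I' I f y v) := by
  have hc0 : curveThrough I' y v 0 = y := curveThrough_zero I' y v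
  have hcd : MDifferentiableAt 𝓘(ℝ, ℝ) I' (curveThrough I' y v) 0 :=
    mdifferentiableAt_curveThrough_zero hy v
  have hfc : MDifferentiableAt I' I f (curveThrough I' y v 0) := by
    rw [hc0]
    exact hf
  have hγ : MDifferentiableAt 𝓘(ℝ, ℝ) I (f ∘ curveThrough I' y v) 0 := hfc.comp 0 hcd
  -- the two lifts agree near `t = 0`
  have hlift : (fun t ↦ (TotalSpace.mk' E ((f ∘ curveThrough I' y v) t)
      (Y ((f ∘ curveThrough I' y v) t)) : TangentBundle I M)) =ᶠ[𝓝 0]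
      fun t ↦ (TotalSpace.mk' E ((f ∘ curveThrough I' y v) t)
        (ν (curveThrough I' y v t)) : TangentBundle I M) := by
    have hct : Tendsto (curveThrough I' y v) (𝓝 0) (𝓝 y) := by
      have h := hcd.continuousAt
      rw [ContinuousAt, hc0] at h
      exact h
    filter_upwards [hct.eventually hν] with t ht
    rw [Function.comp_apply, ht]
  have h1 : g.normalDerivAlong f ν y v = covariantDerivAlong g.leviCivita (f ∘ curveThrough I' y v)
      (fun t ↦ Y ((f ∘ curveThrough I' y v) t)) 0 :=
    (covariantDerivAlong_congr_of_eventuallyEq g.leviCivita hlift).symm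
  -- restriction of a vector field
  have hY' : MDifferentiableAt I I.tangent
      (fun x ↦ (TotalSpace.mk' E x (Y x) : TangentBundle I M)) ((f ∘ curveThrough I' y v) 0) := by
    rw [Function.comp_apply, hc0]
    exact hY
  have h2 := covariantDerivAlong_comp_holds g.leviCivita (γ := f ∘ curveThrough I' y v) (Y := Y)
    (t₀ := 0) hγ hY'
  have hvel : velocity I (f ∘ curveThrough I' y v) 0 =
      mfderiv I' I f (curveThrough I' y v 0) (velocity I' (curveThrough I' y v) 0) := by
    have h := mfderiv_comp 0 hfc hcd
    simp only [velocity]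
    rw [h]
    rfl
  rw [h1, h2, hvel]
  show g.leviCivita Y (f (curveThrough I' y v 0)) (mfderiv I' I f (curveThrough I' y v 0)
    (velocity I' (curveThrough I' y v) 0)) = _
  rw [curveThrough_zero, velocity_curveThrough_zero_holds hy v]

end PseudoRiemannianMetric

/-! ### Linear algebra: unit normals of a hyperplane agree up to sign -/

/-- **Two unit normals of a hyperplane agree up to sign.** In a finite-dimensional space `F`
with a positive definite bilinear form `B`, let `D : W → F` be linear injective with
`dim W + 1 = dim F`; if `ν` and `m` are both `B`-orthogonal to `range D` with
`B(ν, ν) = B(m, m) = 1`, then `ν = B(ν, m) m` with `B(ν, m) = ±1` (`range D ⊕ ℝ m = F` by the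
dimension count; the `range D`-component of `ν` is `B`-isotropic, hence zero). [folklore] -/
theorem eq_smul_of_unit_normals {F W : Type*} [AddCommGroup F] [Module ℝ F]
    [FiniteDimensional ℝ F] [AddCommGroup W] [Module ℝ W] [FiniteDimensional ℝ W]
    (hdim : finrank ℝ W + 1 = finrank ℝ F) (B : LinearMap.BilinForm ℝ F)
    (hpos : ∀ a : F, a ≠ 0 → 0 < B a a) (D : W →ₗ[ℝ] F) (hD : Function.Injective D)
    {ν m : F} (hν : ∀ w, B ν (D w) = 0) (hν1 : B ν ν = 1) (hm : ∀ w, B m (D w) = 0)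
    (hm1 : B m m = 1) :
    ν = (B ν m) • m ∧ (B ν m = 1 ∨ B ν m = -1) := by
  set Rg : Submodule ℝ F := LinearMap.range D with hRgdef
  have hRg : finrank ℝ Rg = finrank ℝ W := LinearMap.finrank_range_of_inj hD
  have hm0 : m ≠ 0 := by
    rintro rfl
    simp at hm1
  have hmR : m ∉ Rg := by
    rintro ⟨w, hw⟩
    have h := hm w
    rw [hw, hm1] at h
    exact one_ne_zero h
  have hsup : Rg ⊔ (ℝ ∙ m) = ⊤ := by
    apply Submodule.eq_top_of_finrank_eq
    have key := Submodule.finrank_sup_add_finrank_inf_eq Rg (ℝ ∙ m)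
    rw [disjoint_iff.mp (Submodule.disjoint_span_singleton_of_notMem hmR), finrank_bot, add_zero,
      hRg, finrank_span_singleton hm0] at key
    rw [key, hdim]
  have hνmem : ν ∈ Rg ⊔ (ℝ ∙ m) := by
    rw [hsup]
    exact Submodule.mem_top
  obtain ⟨a, ha, b, hb, hab⟩ := Submodule.mem_sup.1 hνmem
  obtain ⟨w₀, rfl⟩ := ha
  obtain ⟨t, rfl⟩ := Submodule.mem_span_singleton.1 hb
  -- the `range D`-component of `ν` is isotropic, hence zero
  have hBa : B (D w₀) (D w₀) = 0 := by
    have h := hν w₀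
    rw [← hab] at h
    simpa only [map_add, map_smul, LinearMap.add_apply, LinearMap.smul_apply, hm w₀, smul_eq_mul,
      mul_zero, add_zero] using h
  have ha0 : D w₀ = 0 := by
    by_contra hne
    exact (hpos _ hne).ne' hBa
  have hν' : ν = t • m := by rw [← hab, ha0, zero_add]
  have ht : B ν m = t := by
    rw [hν']
    simp only [map_smul, LinearMap.smul_apply, hm1, smul_eq_mul, mul_one]
  refine ⟨by rw [ht]; exact hν', ?_⟩
  have ht2 : t * t = 1 := by
    have h := hν1
    rw [hν'] at h
    simpa only [map_smul, LinearMap.smul_apply, smul_eq_mul, hm1, mul_one] using h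
  rw [ht]
  exact mul_self_eq_one_iff.1 ht2

/-! ### Expansion along the standard basis of `ℝ²` -/

/-- `Σ aᵢ eᵢ = a` in `ℝ²`. [folklore] -/
theorem sum_smul_stdVec (a : EuclideanSpace ℝ (Fin 2)) : ∑ i, a i • MinimalGraph.stdVec i = a := by
  ext k
  fin_cases k <;> simp [Fin.sum_univ_two]

/-- A continuous linear map on `ℝ²` is determined by the standard basis:
`D a = Σ aᵢ D eᵢ`. [folklore] -/
theorem clm_apply_eq_sum_stdVec {F : Type*} [NormedAddCommGroup F] [NormedSpace ℝ F]
    (D : EuclideanSpace ℝ (Fin 2) →L[ℝ] F) (a : EuclideanSpace ℝ (Fin 2)) :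
    D a = ∑ i, a i • D (MinimalGraph.stdVec i) := by
  conv_lhs => rw [← sum_smul_stdVec a]
  simp [map_smul]

/-- A continuous linear functional on `ℝ²` in coordinates: `D a = Σ (D eᵢ) aᵢ`. [folklore] -/
theorem clm_apply_eq_sum_mul (D : EuclideanSpace ℝ (Fin 2) →L[ℝ] ℝ) (a : EuclideanSpace ℝ (Fin 2)) :
    D a = ∑ i, D (MinimalGraph.stdVec i) * a i := by
  rw [clm_apply_eq_sum_stdVec]
  exact Finset.sum_congr rfl fun i _ ↦ by rw [smul_eq_mul, mul_comm]

/-! ### Geometry of a graph piece of a surface in a chart -/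

namespace MinimalGraphHolds

open MinimalGraph AtlasChart

variable {X : Type*} [TopologicalSpace X]
  {ψ : OpenPartialHomeomorph X E3} {T : E3 ≃L[ℝ] EuclideanSpace ℝ (Fin 2) × ℝ}
  {S : Type*} {f : S → X} {W₀ : Set S} {u : EuclideanSpace ℝ (Fin 2) → ℝ}

variable (ψ T f) in
/-- The horizontal coordinate `φ = (T ∘ ψ ∘ f).1` of the surface in the straightened chart.
[cite: FonteneleSilva2001, §4 (parametrisation over the tangent plane)] -/
def horiz (y : S) : EuclideanSpace ℝ (Fin 2) :=
  (T (ψ (f y))).1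

variable (T u) in
/-- The graph map `Gr_u(x) = T⁻¹(x, u x)` of `u` in the straightened chart.
[cite: AnderssonGallowayHoward1998, §3.1 (the map F_f)] -/
def graphMap (x : EuclideanSpace ℝ (Fin 2)) : E3 :=
  T.symm (x, u x)

variable (u) in
/-- The jet base `(∇u(x), u(x), x)` of `u` at `x`: the last three slots of `jet2 u x`.
[cite: FonteneleSilva2001, §2 (2.2)] -/
def jetBaseOf (x : EuclideanSpace ℝ (Fin 2)) : JetBase :=
  (fun i ↦ fderiv ℝ u x (stdVec i), u x, x)

/-- `(jet2 u x).2 = jetBaseOf u x`. [folklore] -/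
theorem jet2_snd (x : EuclideanSpace ℝ (Fin 2)) : (jet2 u x).2 = jetBaseOf u x := rfl

/-- The base point of the jet base of `u` at `x` is the graph point `Gr_u(x)`. [folklore] -/
theorem basePt_jetBaseOf (x : EuclideanSpace ℝ (Fin 2)) : basePt T (jetBaseOf u x) = graphMap T u x :=
  rfl

/-- The horizontal coordinate of a graph point: `(T (Gr_u x)).1 = x`. [folklore] -/
@[simp]
theorem fst_apply_graphMap (x : EuclideanSpace ℝ (Fin 2)) : (T (graphMap T u x)).1 = x := by
  simp [graphMap]

variable (T u) in
/-- The unit normal of the graph read on the chart target: `p ↦ N(∇u(x'), u(x'), x')`,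
`x' = (T p).1` (constant along the height). [cite: FonteneleSilva2001, §3 (η as a function of x, µ, µ_i)] -/
def normalRep (G : E3 → E3 →L[ℝ] E3 →L[ℝ] ℝ) (p : E3) : E3 :=
  unitNormal T G (jetBaseOf u (T p).1)

section Graph

variable (hsrc : ∀ y ∈ W₀, f y ∈ ψ.source)
  (hgr : ∀ y ∈ W₀, (T (ψ (f y))).2 = u (T (ψ (f y))).1)

include hgr in
/-- On `W₀` the surface read in the chart is the graph: `ψ (f y) = Gr_u(φ y)`. [folklore] -/
theorem chart_apply_eq_graphMap {y : S} (hy : y ∈ W₀) : ψ (f y) = graphMap T u (horiz ψ T f y) := by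
  apply T.injective
  rw [graphMap, ContinuousLinearEquiv.apply_symm_apply]
  exact Prod.ext rfl (hgr y hy)

include hsrc hgr in
/-- The graph points lie in the chart target. [folklore] -/
theorem graphMap_horiz_mem_target {y : S} (hy : y ∈ W₀) : graphMap T u (horiz ψ T f y) ∈ ψ.target := by
  rw [← chart_apply_eq_graphMap hgr hy]
  exact ψ.map_source (hsrc y hy)

include hsrc hgr in
/-- On `W₀` the surface is `f = ψ⁻¹ ∘ Gr_u ∘ φ`. [folklore] -/
theorem apply_eq_symm_graphMap {y : S} (hy : y ∈ W₀) :
    f y = ψ.symm (graphMap T u (horiz ψ T f y)) := by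
  rw [← chart_apply_eq_graphMap hgr hy, ψ.left_inv (hsrc y hy)]

end Graph

/-- The differential of the graph map: `D Gr_u(x) a = T⁻¹(a, Du(x) a)`. [folklore] -/
theorem hasFDerivAt_graphMap {x : EuclideanSpace ℝ (Fin 2)} (hux : DifferentiableAt ℝ u x) :
    HasFDerivAt (graphMap T u)
      ((T.symm : EuclideanSpace ℝ (Fin 2) × ℝ →L[ℝ] E3).comp
        ((ContinuousLinearMap.id ℝ (EuclideanSpace ℝ (Fin 2))).prod (fderiv ℝ u x))) x :=
  (T.symm : EuclideanSpace ℝ (Fin 2) × ℝ →L[ℝ] E3).hasFDerivAt.comp x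
    ((hasFDerivAt_id x).prodMk hux.hasFDerivAt)

/-- The differential of the graph map is the graph differential of the jet:
`D Gr_u(x) a = A_{∇u(x)} a`. [folklore] -/
theorem fderiv_graphMap_apply {x : EuclideanSpace ℝ (Fin 2)} (hux : DifferentiableAt ℝ u x)
    (a : EuclideanSpace ℝ (Fin 2)) :
    fderiv ℝ (graphMap T u) x a = graphDiff T (jetBaseOf u x).1 a := by
  rw [(hasFDerivAt_graphMap hux).fderiv, graphDiff_apply]
  simp only [ContinuousLinearMap.comp_apply, ContinuousLinearEquiv.coe_coe,
    ContinuousLinearMap.prod_apply, ContinuousLinearMap.id_apply]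
  congr 2
  exact clm_apply_eq_sum_mul (fderiv ℝ u x) a

/-- The jet base of `u` is `C¹` on `V` for `u` of class `C²`. [folklore] -/
theorem contDiffAt_jetBaseOf {V : Set (EuclideanSpace ℝ (Fin 2))} (hV : IsOpen V)
    (hu : ContDiffOn ℝ 2 u V) {x : EuclideanSpace ℝ (Fin 2)} (hx : x ∈ V) :
    ContDiffAt ℝ 1 (jetBaseOf u) x := by
  have h1 : ContDiffOn ℝ 1 (fderiv ℝ u) V := hu.fderiv_of_isOpen hV one_add_one_eq_two.le
  have h : ContDiffOn ℝ 1 (jetBaseOf u) V :=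
    (contDiffOn_pi.2 fun i ↦ h1.clm_apply contDiffOn_const).prodMk
      ((hu.of_le one_le_two).prodMk contDiffOn_id)
  exact h.contDiffAt (hV.mem_nhds hx)

/-- The normal representative is `C¹` at the points of the chart target over `V`. [folklore] -/
theorem contDiffAt_normalRep {G : E3 → E3 →L[ℝ] E3 →L[ℝ] ℝ} (hG : MetricCoord.IsMetricOn G ψ.target)
    (hpos : ∀ z ∈ ψ.target, ∀ v : E3, v ≠ 0 → 0 < G z v v)
    {V : Set (EuclideanSpace ℝ (Fin 2))} (hV : IsOpen V) (hu : ContDiffOn ℝ 2 u V) {p : E3}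
    (hpV : (T p).1 ∈ V) (hpt : graphMap T u (T p).1 ∈ ψ.target) :
    ContDiffAt ℝ 1 (normalRep T u G) p := by
  have h1 : ContDiffAt ℝ 1 (fun p : E3 ↦ jetBaseOf u (T p).1) p :=
    (contDiffAt_jetBaseOf hV hu hpV).comp p
      (((ContinuousLinearMap.fst ℝ (EuclideanSpace ℝ (Fin 2)) ℝ).comp
        (T : E3 →L[ℝ] EuclideanSpace ℝ (Fin 2) × ℝ)).contDiff.contDiffAt)
  have h2 : ContDiffAt ℝ 1 (unitNormal T G) (jetBaseOf u (T p).1) :=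
    ((contDiffOn_unitNormal hG hpos).contDiffAt
      ((isOpen_basePt_preimage hG.isOpen).mem_nhds hpt)).of_le (by exact_mod_cast le_top)
  exact h2.comp p h1

/-- The jet prolongation direction of `jet2 u x` is the derivative of the jet base of `u`:
`jetDir (jet2 u x) a = (D(∇u)(x) a, Du(x) a, a)`. [cite: FonteneleSilva2001, §2 (2.2)] -/
theorem jetDir_jet2 (x : EuclideanSpace ℝ (Fin 2)) (a : EuclideanSpace ℝ (Fin 2)) :
    jetDir (jet2 u x) a =
      (fun j ↦ fderiv ℝ (fun x' ↦ fderiv ℝ u x' (stdVec j)) x a, fderiv ℝ u x a, a) := by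
  refine Prod.ext (funext fun j ↦ ?_) (Prod.ext ?_ rfl)
  · show ∑ i, a i * fderiv ℝ (fun y ↦ fderiv ℝ u y (EuclideanSpace.single j 1)) x
      (EuclideanSpace.single i 1) = fderiv ℝ (fun x' ↦ fderiv ℝ u x' (stdVec j)) x a
    rw [clm_apply_eq_sum_mul (fderiv ℝ (fun x' ↦ fderiv ℝ u x' (stdVec j)) x) a]
    exact Finset.sum_congr rfl fun i _ ↦ by rw [mul_comm]; rfl
  · show ∑ i, fderiv ℝ u x (EuclideanSpace.single i 1) * a i = fderiv ℝ u x a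
    rw [clm_apply_eq_sum_mul (fderiv ℝ u x) a]
    rfl

/-- **The derivative of the unit normal along the graph is the symbol `DÑ` of the jet**:
`D(normalRep)(Gr_u x)(A_{∇u x} a) = unitNormalDeriv (jet2 u x) a` (chain rule through the jet
base). [cite: FonteneleSilva2001, §3 (3.3)] -/
theorem fderiv_normalRep_graphDiff {G : E3 → E3 →L[ℝ] E3 →L[ℝ] ℝ}
    (hG : MetricCoord.IsMetricOn G ψ.target) (hpos : ∀ z ∈ ψ.target, ∀ v : E3, v ≠ 0 → 0 < G z v v)
    {V : Set (EuclideanSpace ℝ (Fin 2))} (hV : IsOpen V) (hu : ContDiffOn ℝ 2 u V)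
    {x : EuclideanSpace ℝ (Fin 2)} (hx : x ∈ V) (hz : graphMap T u x ∈ ψ.target)
    (a : EuclideanSpace ℝ (Fin 2)) :
    fderiv ℝ (normalRep T u G) (graphMap T u x) (graphDiff T (jetBaseOf u x).1 a) =
      unitNormalDeriv T G (jet2 u x) a := by
  -- the derivative `J` of the jet base at `x`
  have h1 : ContDiffOn ℝ 1 (fderiv ℝ u) V := hu.fderiv_of_isOpen hV one_add_one_eq_two.le
  have hDu : DifferentiableAt ℝ (fderiv ℝ u) x :=
    (h1.differentiableOn one_ne_zero).differentiableAt (hV.mem_nhds hx)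
  have hux : DifferentiableAt ℝ u x :=
    (hu.differentiableOn two_ne_zero).differentiableAt (hV.mem_nhds hx)
  set J : EuclideanSpace ℝ (Fin 2) →L[ℝ] JetBase :=
    (ContinuousLinearMap.pi fun i ↦ fderiv ℝ (fun x' ↦ fderiv ℝ u x' (stdVec i)) x).prod
      ((fderiv ℝ u x).prod (ContinuousLinearMap.id ℝ (EuclideanSpace ℝ (Fin 2)))) with hJdef
  have hJ : HasFDerivAt (jetBaseOf u) J x := by
    refine (hasFDerivAt_pi.2 fun i ↦ ?_).prodMk (hux.hasFDerivAt.prodMk (hasFDerivAt_id x))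
    exact (hDu.clm_apply (differentiableAt_const _)).hasFDerivAt
  have hJa : ∀ a', J a' = jetDir (jet2 u x) a' := fun a' ↦ by
    rw [jetDir_jet2]
    rfl
  -- chain rule through `p ↦ (T p).1`
  set F : E3 →L[ℝ] EuclideanSpace ℝ (Fin 2) :=
    (ContinuousLinearMap.fst ℝ (EuclideanSpace ℝ (Fin 2)) ℝ).comp
      (T : E3 →L[ℝ] EuclideanSpace ℝ (Fin 2) × ℝ) with hFdef
  have hF : HasFDerivAt (fun p : E3 ↦ (T p).1) F (graphMap T u x) := F.hasFDerivAt
  have hJ' : HasFDerivAt (jetBaseOf u) J ((fun p : E3 ↦ (T p).1) (graphMap T u x)) := by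
    simp only [fst_apply_graphMap]
    exact hJ
  have hcomp : HasFDerivAt (jetBaseOf u ∘ fun p : E3 ↦ (T p).1) (J.comp F) (graphMap T u x) :=
    hJ'.comp (graphMap T u x) hF
  have hNd : DifferentiableAt ℝ (unitNormal T G) (jetBaseOf u x) := differentiableAt_unitNormal hG hpos hz
  have hN : HasFDerivAt (unitNormal T G) (fderiv ℝ (unitNormal T G) (jetBaseOf u x))
      ((jetBaseOf u ∘ fun p : E3 ↦ (T p).1) (graphMap T u x)) := by
    simp only [Function.comp_apply, fst_apply_graphMap]
    exact hNd.hasFDerivAt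
  have h := (hN.comp (graphMap T u x) hcomp).fderiv
  show fderiv ℝ (unitNormal T G ∘ (jetBaseOf u ∘ fun p : E3 ↦ (T p).1)) (graphMap T u x)
    (graphDiff T (jetBaseOf u x).1 a) = _
  rw [h, ContinuousLinearMap.comp_apply, ContinuousLinearMap.comp_apply]
  have hFa : F (graphDiff T (jetBaseOf u x).1 a) = a := by
    simp [hFdef]
  rw [hFa, hJa]
  rfl

variable [ChartedSpace E3 X] [TopologicalSpace S] [ChartedSpace (EuclideanSpace ℝ (Fin 2)) S]

/-- The horizontal coordinate is differentiable, with differential `(T ∘ dψ ∘ df).1`. [folklore] -/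
theorem hasMFDerivAt_horiz (hψ : ψ ∈ IsManifold.maximalAtlas (𝓡 3) ∞ X) {y : S}
    (hfd : MDifferentiableAt (𝓡 2) (𝓡 3) f y) (hys : f y ∈ ψ.source) :
    HasMFDerivAt (𝓡 2) 𝓘(ℝ, EuclideanSpace ℝ (Fin 2)) (horiz ψ T f) y
      ((((ContinuousLinearMap.fst ℝ (EuclideanSpace ℝ (Fin 2)) ℝ).comp
        (T : E3 →L[ℝ] EuclideanSpace ℝ (Fin 2) × ℝ)).comp (mfderiv (𝓡 3) (𝓡 3) ψ (f y))).comp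
        (mfderiv (𝓡 2) (𝓡 3) f y)) := by
  have h1 : HasMFDerivAt (𝓡 2) (𝓡 3) f y (mfderiv (𝓡 2) (𝓡 3) f y) := hfd.hasMFDerivAt
  have h2 : HasMFDerivAt (𝓡 3) (𝓡 3) ψ (f y) (mfderiv (𝓡 3) (𝓡 3) ψ (f y)) :=
    ((mdifferentiable_chart hψ).mdifferentiableAt hys).hasMFDerivAt
  have h3 : HasMFDerivAt 𝓘(ℝ, E3) 𝓘(ℝ, EuclideanSpace ℝ (Fin 2))
      (fun p : E3 ↦ (T p).1) (ψ (f y))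
      ((ContinuousLinearMap.fst ℝ (EuclideanSpace ℝ (Fin 2)) ℝ).comp
        (T : E3 →L[ℝ] EuclideanSpace ℝ (Fin 2) × ℝ)) :=
    (((ContinuousLinearMap.fst ℝ (EuclideanSpace ℝ (Fin 2)) ℝ).comp
      (T : E3 →L[ℝ] EuclideanSpace ℝ (Fin 2) × ℝ)).hasFDerivAt).hasMFDerivAt
  exact (h3.comp (f y) h2).comp y h1

/-- **The differential of the surface factors through the graph**: on `W₀`,
`f = ψ⁻¹ ∘ Gr_u ∘ φ`, so `df_y = dψ⁻¹ ∘ D Gr_u ∘ dφ_y`. [folklore] -/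
theorem mfderiv_eq_graph (hψ : ψ ∈ IsManifold.maximalAtlas (𝓡 3) ∞ X) (hW₀ : IsOpen W₀)
    (hsrc : ∀ y ∈ W₀, f y ∈ ψ.source) (hgr : ∀ y ∈ W₀, (T (ψ (f y))).2 = u (T (ψ (f y))).1)
    {y : S} (hy : y ∈ W₀) (hfd : MDifferentiableAt (𝓡 2) (𝓡 3) f y)
    (hux : DifferentiableAt ℝ u (horiz ψ T f y)) :
    mfderiv (𝓡 2) (𝓡 3) f y =
      (mfderiv 𝓘(ℝ, E3) (𝓡 3) ψ.symm (graphMap T u (horiz ψ T f y))).comp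
        ((fderiv ℝ (graphMap T u) (horiz ψ T f y)).comp
          (mfderiv (𝓡 2) 𝓘(ℝ, EuclideanSpace ℝ (Fin 2)) (horiz ψ T f) y)) := by
  have hev : f =ᶠ[𝓝 y] fun y' ↦ ψ.symm (graphMap T u (horiz ψ T f y')) := by
    filter_upwards [hW₀.mem_nhds hy] with y' hy'
    exact apply_eq_symm_graphMap hsrc hgr hy'
  have h1 : HasMFDerivAt (𝓡 2) 𝓘(ℝ, EuclideanSpace ℝ (Fin 2)) (horiz ψ T f) y
      (mfderiv (𝓡 2) 𝓘(ℝ, EuclideanSpace ℝ (Fin 2)) (horiz ψ T f) y) :=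
    (hasMFDerivAt_horiz hψ hfd (hsrc y hy)).mdifferentiableAt.hasMFDerivAt
  have h2 : HasMFDerivAt 𝓘(ℝ, EuclideanSpace ℝ (Fin 2)) 𝓘(ℝ, E3) (graphMap T u) (horiz ψ T f y)
      (fderiv ℝ (graphMap T u) (horiz ψ T f y)) :=
    (hasFDerivAt_graphMap hux).differentiableAt.hasFDerivAt.hasMFDerivAt
  have h3 : HasMFDerivAt 𝓘(ℝ, E3) (𝓡 3) ψ.symm (graphMap T u (horiz ψ T f y))
      (mfderiv 𝓘(ℝ, E3) (𝓡 3) ψ.symm (graphMap T u (horiz ψ T f y))) :=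
    ((mdifferentiable_chart hψ).symm.mdifferentiableAt
      (graphMap_horiz_mem_target hsrc hgr hy)).hasMFDerivAt
  have hcomp := (h3.comp (horiz ψ T f y) h2).comp y h1
  exact (hcomp.congr_of_eventuallyEq hev).mfderiv

/-- Applied form: `df_y v = dψ⁻¹_{Gr(φ y)} (A_{∇u(φ y)} (dφ_y v))`. [folklore] -/
theorem mfderiv_apply_eq_graph (hψ : ψ ∈ IsManifold.maximalAtlas (𝓡 3) ∞ X) (hW₀ : IsOpen W₀)
    (hsrc : ∀ y ∈ W₀, f y ∈ ψ.source) (hgr : ∀ y ∈ W₀, (T (ψ (f y))).2 = u (T (ψ (f y))).1)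
    {y : S} (hy : y ∈ W₀) (hfd : MDifferentiableAt (𝓡 2) (𝓡 3) f y)
    (hux : DifferentiableAt ℝ u (horiz ψ T f y)) (v : TangentSpace (𝓡 2) y) :
    mfderiv (𝓡 2) (𝓡 3) f y v =
      mfderiv 𝓘(ℝ, E3) (𝓡 3) ψ.symm (graphMap T u (horiz ψ T f y))
        (graphDiff T (jetBaseOf u (horiz ψ T f y)).1
          (mfderiv (𝓡 2) 𝓘(ℝ, EuclideanSpace ℝ (Fin 2)) (horiz ψ T f) y v)) := by
  rw [mfderiv_eq_graph hψ hW₀ hsrc hgr hy hfd hux]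
  show mfderiv 𝓘(ℝ, E3) (𝓡 3) ψ.symm (graphMap T u (horiz ψ T f y))
    (fderiv ℝ (graphMap T u) (horiz ψ T f y)
      (mfderiv (𝓡 2) 𝓘(ℝ, EuclideanSpace ℝ (Fin 2)) (horiz ψ T f) y v)) = _
  rw [fderiv_graphMap_apply hux]

/-- **The horizontal coordinate is a local diffeomorphism**: `dφ_y` is bijective (if `dφ v = 0`
then `df v = dψ⁻¹(A 0) = 0`, and `df` is injective; dimensions agree). [folklore] -/
theorem bijective_mfderiv_horiz (hψ : ψ ∈ IsManifold.maximalAtlas (𝓡 3) ∞ X) (hW₀ : IsOpen W₀)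
    (hsrc : ∀ y ∈ W₀, f y ∈ ψ.source) (hgr : ∀ y ∈ W₀, (T (ψ (f y))).2 = u (T (ψ (f y))).1)
    {y : S} (hy : y ∈ W₀) (hfd : MDifferentiableAt (𝓡 2) (𝓡 3) f y)
    (hinj : Function.Injective (mfderiv (𝓡 2) (𝓡 3) f y))
    (hux : DifferentiableAt ℝ u (horiz ψ T f y)) :
    Function.Bijective (mfderiv (𝓡 2) 𝓘(ℝ, EuclideanSpace ℝ (Fin 2)) (horiz ψ T f) y) := by
  have hi : Function.Injective (mfderiv (𝓡 2) 𝓘(ℝ, EuclideanSpace ℝ (Fin 2)) (horiz ψ T f) y) := by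
    intro v w hvw
    apply hinj
    rw [mfderiv_apply_eq_graph hψ hW₀ hsrc hgr hy hfd hux,
      mfderiv_apply_eq_graph hψ hW₀ hsrc hgr hy hfd hux, hvw]
  haveI : FiniteDimensional ℝ (TangentSpace (𝓡 2) y) :=
    inferInstanceAs (FiniteDimensional ℝ (EuclideanSpace ℝ (Fin 2)))
  haveI : FiniteDimensional ℝ (TangentSpace 𝓘(ℝ, EuclideanSpace ℝ (Fin 2)) (horiz ψ T f y)) :=
    inferInstanceAs (FiniteDimensional ℝ (EuclideanSpace ℝ (Fin 2)))
  exact ⟨hi, (LinearMap.injective_iff_surjective_of_finrank_eq_finrank (rfl :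
    finrank ℝ (TangentSpace (𝓡 2) y) =
      finrank ℝ (TangentSpace 𝓘(ℝ, EuclideanSpace ℝ (Fin 2)) (horiz ψ T f y)))
    (f := (mfderiv (𝓡 2) 𝓘(ℝ, EuclideanSpace ℝ (Fin 2)) (horiz ψ T f) y).toLinearMap)).1 hi⟩

/-! ### The metric, the unit normal and the second fundamental form in the chart -/

section Chart

variable [IsManifold (𝓡 3) ∞ X] (g : PseudoRiemannianMetric (𝓡 3) ∞ E3 (TangentSpace (𝓡 3) : X → Type _))

/-- Cross-point equation for the metric: equal base points, same vectors of `E3`. [folklore] -/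
theorem val_congr_point {x x' : X} (h : x = x') (a c : E3) : (g.val x a c : ℝ) = g.val x' a c := by
  subst h
  rfl

omit [IsManifold (𝓡 3) ∞ X] in
/-- Cross-point equation for the differential of the inverse chart. [folklore] -/
theorem mfderiv_symm_congr_point {z z' : E3} (h : z = z') (e : E3) :
    (mfderiv 𝓘(ℝ, E3) (𝓡 3) ψ.symm z e : E3) = mfderiv 𝓘(ℝ, E3) (𝓡 3) ψ.symm z' e := by
  subst h
  rfl

/-- Cross-point equation for the Levi-Civita connection. [folklore] -/
theorem leviCivita_congr_point [g.HasLeviCivita] {Y : Π x : X, TangentSpace (𝓡 3) x} {x x' : X}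
    (h : x = x') (e : E3) : (g.leviCivita Y x e : E3) = g.leviCivita Y x' e := by
  subst h
  rfl

/-- **The metric on vectors pushed by the inverse chart is given by the chart components**:
`g_{ψ⁻¹ z}(dψ⁻¹ a, dψ⁻¹ c) = G'(z)(a, c)`, `G' = AtlasChart.metricRepr`. [folklore] -/
theorem val_symm_mfderiv_symm (hψ : ψ ∈ IsManifold.maximalAtlas (𝓡 3) ∞ X) {z : E3}
    (hz : z ∈ ψ.target) (a c : E3) :
    g.val (ψ.symm z) (mfderiv 𝓘(ℝ, E3) (𝓡 3) ψ.symm z a) (mfderiv 𝓘(ℝ, E3) (𝓡 3) ψ.symm z c) =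
      metricRepr g hψ z a c := by
  have h1 := metric_val g hψ ⟨z, hz⟩ a c
  rw [mfderiv_inv hψ] at h1
  have h2 := DFunLike.congr_fun (DFunLike.congr_fun (metric_val_eq_repr g hψ ⟨z, hz⟩) a) c
  exact h1.symm.trans h2

/-- The chart components form a metric on the target (`OpensChart.isMetricOn_repr`). [folklore] -/
theorem isMetricOn_metricRepr (hψ : ψ ∈ IsManifold.maximalAtlas (𝓡 3) ∞ X) :
    MetricCoord.IsMetricOn (metricRepr g hψ) ψ.target :=
  OpensChart.isMetricOn_repr (metric_val_eq_repr g hψ)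

/-- The chart components of a Riemannian metric are positive definite on the target. [folklore] -/
theorem metricRepr_pos (hψ : ψ ∈ IsManifold.maximalAtlas (𝓡 3) ∞ X) (hg : g.IsRiemannian) :
    ∀ z ∈ ψ.target, ∀ v : E3, v ≠ 0 → 0 < metricRepr g hψ z v v := by
  intro z hz v hv
  have h := isRiemannian_metric g hψ hg ⟨z, hz⟩ v hv
  rwa [metric_val_eq_repr g hψ ⟨z, hz⟩] at h

/-- **The induced metric of the surface in the chart is the first fundamental form of the graph**:
`g(df v, df w) = γ̃(dφ v, dφ w)` at the jet base of `u`. [cite: FonteneleSilva2001, Lemma 3.1 (the matrix I)] -/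
theorem val_mfderiv_mfderiv_eq_firstFF (hψ : ψ ∈ IsManifold.maximalAtlas (𝓡 3) ∞ X)
    (hW₀ : IsOpen W₀) (hsrc : ∀ y ∈ W₀, f y ∈ ψ.source)
    (hgr : ∀ y ∈ W₀, (T (ψ (f y))).2 = u (T (ψ (f y))).1) {y : S} (hy : y ∈ W₀)
    (hfd : MDifferentiableAt (𝓡 2) (𝓡 3) f y) (hux : DifferentiableAt ℝ u (horiz ψ T f y))
    (v w : TangentSpace (𝓡 2) y) :
    g.val (f y) (mfderiv (𝓡 2) (𝓡 3) f y v) (mfderiv (𝓡 2) (𝓡 3) f y w) =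
      firstFF T (metricRepr g hψ) (jetBaseOf u (horiz ψ T f y))
        (mfderiv (𝓡 2) 𝓘(ℝ, EuclideanSpace ℝ (Fin 2)) (horiz ψ T f) y v)
        (mfderiv (𝓡 2) 𝓘(ℝ, EuclideanSpace ℝ (Fin 2)) (horiz ψ T f) y w) := by
  rw [mfderiv_apply_eq_graph hψ hW₀ hsrc hgr hy hfd hux v,
    mfderiv_apply_eq_graph hψ hW₀ hsrc hgr hy hfd hux w,
    val_congr_point g (apply_eq_symm_graphMap hsrc hgr hy),
    val_symm_mfderiv_symm g hψ (graphMap_horiz_mem_target hsrc hgr hy)]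
  rfl

/-- **The unit normal of the surface is, near `y₀`, the push-forward of `±N`.** For `y` in the
graph piece `W₀` the vector `dψ⁻¹ N(∇u(φ y), u(φ y), φ y)` is a `g`-unit normal to `df(T_y S)`
(`G'(N, A a) = 0`, `G'(N, N) = 1`), so the given unit normal `ν y` is `±` it
(`eq_smul_of_unit_normals`); the sign `g(ν, ·)` is continuous (`contMDiffAt_val_apply_along`),
hence locally constant, and `ν = ψ^*(s₀ normalRep) ∘ f` near `y₀`.
[cite: FonteneleSilva2001, §1 (the local orientation η with η(0) = η₀)] -/
theorem exists_sign_eventually_eq (hψ : ψ ∈ IsManifold.maximalAtlas (𝓡 3) ∞ X) (hW₀ : IsOpen W₀)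
    (hsrc : ∀ y ∈ W₀, f y ∈ ψ.source) (hgr : ∀ y ∈ W₀, (T (ψ (f y))).2 = u (T (ψ (f y))).1)
    (hg : g.IsRiemannian) {V : Set (EuclideanSpace ℝ (Fin 2))} (hV : IsOpen V)
    (hu : ContDiffOn ℝ 2 u V) (hφV : ∀ y ∈ W₀, horiz ψ T f y ∈ V)
    (hf : ContMDiff (𝓡 2) (𝓡 3) ∞ f)
    (hinj : ∀ y, Function.Injective (mfderiv (𝓡 2) (𝓡 3) f y)) {ν : NormalField (𝓡 3) f}
    (hunit : g.IsUnitNormal (𝓡 2) f ν 1)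
    (hν : ContMDiff (𝓡 2) (𝓡 3).tangent ∞
      (fun y ↦ (TotalSpace.mk' E3 (f y) (ν y) : TangentBundle (𝓡 3) X)))
    {y₀ : S} (hy₀ : y₀ ∈ W₀) :
    ∃ s : ℝ, (s = 1 ∨ s = -1) ∧ ∀ᶠ y in 𝓝 y₀,
      ν y = mpullback (𝓡 3) 𝓘(ℝ, E3) ψ (fun p ↦ s • normalRep T u (metricRepr g hψ) p) (f y) := by
  have hG' : MetricCoord.IsMetricOn (metricRepr g hψ) ψ.target := isMetricOn_metricRepr g hψ
  have hpos := metricRepr_pos g hψ hg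
  -- the candidate normal read on `X`
  set m : Π y : S, TangentSpace (𝓡 3) (f y) := fun y ↦
    mpullback (𝓡 3) 𝓘(ℝ, E3) ψ (fun p ↦ normalRep T u (metricRepr g hψ) p) (f y) with hmdef
  have hm_eq : ∀ y ∈ W₀, (m y : E3) = mfderiv 𝓘(ℝ, E3) (𝓡 3) ψ.symm (graphMap T u (horiz ψ T f y))
      (unitNormal T (metricRepr g hψ) (jetBaseOf u (horiz ψ T f y))) := by
    intro y hy
    show mpullback (𝓡 3) 𝓘(ℝ, E3) ψ (fun p ↦ normalRep T u (metricRepr g hψ) p) (f y) = _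
    rw [mpullback_apply, inverse_mfderiv_chart hψ (hsrc y hy)]
    exact mfderiv_symm_congr_point (chart_apply_eq_graphMap hgr hy) _
  have hunit_m : ∀ y ∈ W₀, (∀ w, g.val (f y) (m y) (mfderiv (𝓡 2) (𝓡 3) f y w) = 0) ∧
      g.val (f y) (m y) (m y) = 1 := by
    intro y hy
    have hux : DifferentiableAt ℝ u (horiz ψ T f y) :=
      (hu.differentiableOn two_ne_zero).differentiableAt (hV.mem_nhds (hφV y hy))
    have hfd : MDifferentiableAt (𝓡 2) (𝓡 3) f y := hf.mdifferentiableAt (by simp)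
    have hz : graphMap T u (horiz ψ T f y) ∈ ψ.target := graphMap_horiz_mem_target hsrc hgr hy
    have hinv : (metricRepr g hψ (basePt T (jetBaseOf u (horiz ψ T f y)))).IsInvertible :=
      hG'.isInvertible _ hz
    have hposb : ∀ v : E3, v ≠ 0 →
        0 < metricRepr g hψ (basePt T (jetBaseOf u (horiz ψ T f y))) v v := hpos _ hz
    constructor
    · intro w
      rw [hm_eq y hy, mfderiv_apply_eq_graph hψ hW₀ hsrc hgr hy hfd hux w,
        val_congr_point g (apply_eq_symm_graphMap hsrc hgr hy), val_symm_mfderiv_symm g hψ hz]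
      exact apply_unitNormal_graphDiff hinv _
    · rw [hm_eq y hy, val_congr_point g (apply_eq_symm_graphMap hsrc hgr hy),
        val_symm_mfderiv_symm g hψ hz]
      exact apply_unitNormal_self hinv hposb
  -- pointwise: `ν = ± m`
  have hsign : ∀ y ∈ W₀, ν y = (g.val (f y) (ν y) (m y)) • m y ∧
      (g.val (f y) (ν y) (m y) = 1 ∨ g.val (f y) (ν y) (m y) = -1) := by
    intro y hy
    haveI : FiniteDimensional ℝ (TangentSpace (𝓡 3) (f y)) :=
      inferInstanceAs (FiniteDimensional ℝ E3)
    haveI : FiniteDimensional ℝ (TangentSpace (𝓡 2) y) :=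
      inferInstanceAs (FiniteDimensional ℝ (EuclideanSpace ℝ (Fin 2)))
    have hdim : finrank ℝ (TangentSpace (𝓡 2) y) + 1 = finrank ℝ (TangentSpace (𝓡 3) (f y)) := by
      show finrank ℝ (EuclideanSpace ℝ (Fin 2)) + 1 = finrank ℝ E3
      rw [finrank_euclideanSpace_fin, finrank_euclideanSpace_fin]
    exact eq_smul_of_unit_normals hdim (g.toBilinForm (f y)) (fun a ha ↦ hg (f y) a ha)
      ((mfderiv (𝓡 2) (𝓡 3) f y : TangentSpace (𝓡 2) y →ₗ[ℝ] TangentSpace (𝓡 3) (f y)))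
      (hinj y) (hunit.1 y) (hunit.2 y) (hunit_m y hy).1 (hunit_m y hy).2
  -- the sign is continuous at `y₀`
  have hcont : ContinuousAt (fun y ↦ g.val (f y) (ν y) (m y)) y₀ := by
    have hA : ContMDiffAt (𝓡 2) (𝓡 3).tangent 0
        (fun y ↦ (TotalSpace.mk' E3 (f y) (ν y) : TangentBundle (𝓡 3) X)) y₀ :=
      (hν y₀).of_le (by simp)
    have hnR : ContMDiffAt 𝓘(ℝ, E3) (𝓘(ℝ, E3).prod 𝓘(ℝ, E3)) 0
        (fun p : E3 ↦ (TotalSpace.mk' E3 p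
          (show TangentSpace 𝓘(ℝ, E3) p from normalRep T u (metricRepr g hψ) p) :
            TangentBundle 𝓘(ℝ, E3) E3)) (ψ (f y₀)) := by
      rw [contMDiffAt_section]
      simp only [trivializationAt_model_space_apply]
      rw [contMDiffAt_iff_contDiffAt]
      have hx₀V : (T (ψ (f y₀))).1 ∈ V := hφV y₀ hy₀
      have hz : graphMap T u (T (ψ (f y₀))).1 ∈ ψ.target := graphMap_horiz_mem_target hsrc hgr hy₀
      exact (contDiffAt_normalRep hG' hpos hV hu hx₀V hz).of_le (by simp)
    have hψx : ContMDiffAt (𝓡 3) 𝓘(ℝ, E3) ∞ ψ (f y₀) :=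
      (contMDiffOn_of_mem_maximalAtlas hψ).contMDiffAt (ψ.open_source.mem_nhds (hsrc y₀ hy₀))
    have hinvt : (mfderiv (𝓡 3) 𝓘(ℝ, E3) ψ (f y₀)).IsInvertible := by
      refine ⟨(mdifferentiable_chart hψ).mfderiv (hsrc y₀ hy₀), ?_⟩
      ext v
      rfl
    have hpull := ContMDiffAt.mpullback_vectorField_preimage (I := 𝓡 3) (I' := 𝓘(ℝ, E3))
      hnR hψx hinvt (by exact_mod_cast le_top)
    have hB : ContMDiffAt (𝓡 2) (𝓡 3).tangent 0
        (fun y ↦ (TotalSpace.mk' E3 (f y) (m y) : TangentBundle (𝓡 3) X)) y₀ :=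
      hpull.comp y₀ ((hf y₀).of_le (by simp))
    exact (contMDiffAt_val_apply_along g (by simp) hA hB).continuousAt
  -- hence locally constant
  obtain ⟨_, hs₀⟩ := hsign y₀ hy₀
  refine ⟨g.val (f y₀) (ν y₀) (m y₀), hs₀, ?_⟩
  filter_upwards [Metric.tendsto_nhds.1 hcont 1 one_pos, hW₀.mem_nhds hy₀] with y hy hyW
  obtain ⟨hνy, hsy⟩ := hsign y hyW
  have hcs : g.val (f y) (ν y) (m y) = g.val (f y₀) (ν y₀) (m y₀) := by
    rw [Real.dist_eq] at hy
    rcases hsy with h | h <;> rcases hs₀ with h' | h' <;> rw [h, h'] at hy ⊢ <;> norm_num at hy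
  rw [hνy, hcs]
  show g.val (f y₀) (ν y₀) (m y₀) •
      mpullback (𝓡 3) 𝓘(ℝ, E3) ψ (fun p ↦ normalRep T u (metricRepr g hψ) p) (f y) = _
  rw [mpullback_apply, mpullback_apply]
  exact (ContinuousLinearMap.map_smul _ _ _).symm

variable [IsManifold (𝓡 2) ∞ S]

/-- **The second fundamental form of the surface in the chart is `±K̃` of the jet**:
`K_ν(v, w) = s₀ K̃_{jet2 u (φ y₀)}(dφ v, dφ w)` whenever `ν = ψ^*(s₀ normalRep) ∘ f` near `y₀`
(`secondFundamentalForm_apply_holds`; `D_v ν = ∇_{df v}(ψ^* Y)` by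
`normalDerivAlong_eq_leviCivita_of_eventuallyEq`; the chart formula
`AtlasChart.leviCivita_mpullback_chart`; `df = dψ⁻¹ ∘ A ∘ dφ`; the chain rule
`fderiv_normalRep_graphDiff`; `christoffel = chrAt`). This is Fontenele–Silva's
`II(x)_{kl} = ⟨∇_{ϕ_k} ϕ_l, η⟩ = G(µ_ij, µ_i, µ, x)_{kl}` for the chart inverse.
[cite: FonteneleSilva2001, Lemma 3.1 ((3.3)–(3.4))] -/
theorem secondFundamentalForm_eq_sff [g.HasLeviCivita]
    (hψ : ψ ∈ IsManifold.maximalAtlas (𝓡 3) ∞ X) (hW₀ : IsOpen W₀)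
    (hsrc : ∀ y ∈ W₀, f y ∈ ψ.source) (hgr : ∀ y ∈ W₀, (T (ψ (f y))).2 = u (T (ψ (f y))).1)
    (hg : g.IsRiemannian) {V : Set (EuclideanSpace ℝ (Fin 2))} (hV : IsOpen V)
    (hu : ContDiffOn ℝ 2 u V) (hφV : ∀ y ∈ W₀, horiz ψ T f y ∈ V)
    (hf : ContMDiff (𝓡 2) (𝓡 3) ∞ f) {ν : NormalField (𝓡 3) f}
    (hν : ContMDiff (𝓡 2) (𝓡 3).tangent ∞
      (fun y ↦ (TotalSpace.mk' E3 (f y) (ν y) : TangentBundle (𝓡 3) X)))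
    {y₀ : S} (hy₀ : y₀ ∈ W₀) {s₀ : ℝ}
    (hev : ∀ᶠ y in 𝓝 y₀,
      ν y = mpullback (𝓡 3) 𝓘(ℝ, E3) ψ (fun p ↦ s₀ • normalRep T u (metricRepr g hψ) p) (f y))
    (v w : TangentSpace (𝓡 2) y₀) :
    g.secondFundamentalForm (𝓡 2) f ν y₀ v w =
      s₀ * sff T (metricRepr g hψ) (jet2 u (horiz ψ T f y₀))
        (mfderiv (𝓡 2) 𝓘(ℝ, EuclideanSpace ℝ (Fin 2)) (horiz ψ T f) y₀ v)
        (mfderiv (𝓡 2) 𝓘(ℝ, EuclideanSpace ℝ (Fin 2)) (horiz ψ T f) y₀ w) := by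
  have hG' : MetricCoord.IsMetricOn (metricRepr g hψ) ψ.target := isMetricOn_metricRepr g hψ
  have hpos := metricRepr_pos g hψ hg
  have hx₀V : horiz ψ T f y₀ ∈ V := hφV y₀ hy₀
  have hux : DifferentiableAt ℝ u (horiz ψ T f y₀) :=
    (hu.differentiableOn two_ne_zero).differentiableAt (hV.mem_nhds hx₀V)
  have hfd : MDifferentiableAt (𝓡 2) (𝓡 3) f y₀ := hf.mdifferentiableAt (by simp)
  have hz₀ : graphMap T u (horiz ψ T f y₀) ∈ ψ.target := graphMap_horiz_mem_target hsrc hgr hy₀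
  set p₀ : target ψ := ⟨graphMap T u (horiz ψ T f y₀), hz₀⟩ with hp₀
  have hψz : ψ (f y₀) = graphMap T u (horiz ψ T f y₀) := chart_apply_eq_graphMap hgr hy₀
  have hTz : (T (graphMap T u (horiz ψ T f y₀))).1 = horiz ψ T f y₀ := fst_apply_graphMap _
  -- differentiability of the representative and of the pushed-forward field
  have hnRd : DifferentiableAt ℝ (normalRep T u (metricRepr g hψ)) (graphMap T u (horiz ψ T f y₀)) :=
    (contDiffAt_normalRep hG' hpos hV hu (by rw [hTz]; exact hx₀V)
      (by rw [hTz]; exact hz₀)).differentiableAt one_ne_zero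
  have hYfd : DifferentiableAt ℝ (fun p ↦ s₀ • normalRep T u (metricRepr g hψ) p)
      (graphMap T u (horiz ψ T f y₀)) := hnRd.const_smul s₀
  have hYd : MDifferentiableAt (𝓡 3) ((𝓡 3).prod 𝓘(ℝ, E3))
      (fun x' : X ↦ (TotalSpace.mk' E3 x' (mpullback (𝓡 3) 𝓘(ℝ, E3) ψ
        (fun q ↦ s₀ • normalRep T u (metricRepr g hψ) q) x') : TangentBundle (𝓡 3) X)) (f y₀) :=
    mdifferentiableAt_mpullback_chart hψ (hsrc y₀ hy₀) (by rw [hψz]; exact hYfd)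
  -- `D_v ν = ∇_{df v} (ψ^* Y)`
  have hD : ∀ v', g.normalDerivAlong f ν y₀ v' =
      g.leviCivita (mpullback (𝓡 3) 𝓘(ℝ, E3) ψ (fun q ↦ s₀ • normalRep T u (metricRepr g hψ) q))
        (f y₀) (mfderiv (𝓡 2) (𝓡 3) f y₀ v') := fun v' ↦
    g.normalDerivAlong_eq_leviCivita_of_eventuallyEq BoundarylessManifold.isInteriorPoint hfd hYd hev v'
  -- the chart formula at `p₀`
  have hchart : ∀ w' : E3, (g.leviCivita (mpullback (𝓡 3) 𝓘(ℝ, E3) ψ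
      (fun q ↦ s₀ • normalRep T u (metricRepr g hψ) q))
      (ψ.symm (graphMap T u (horiz ψ T f y₀)))
      (mfderiv 𝓘(ℝ, E3) (𝓡 3) ψ.symm (graphMap T u (horiz ψ T f y₀)) w') : E3) =
      mfderiv 𝓘(ℝ, E3) (𝓡 3) ψ.symm (graphMap T u (horiz ψ T f y₀))
        (fderiv ℝ (fun p ↦ s₀ • normalRep T u (metricRepr g hψ) p) (graphMap T u (horiz ψ T f y₀)) w' +
          OpensChart.christoffel (metric g hψ) (metricRepr g hψ) p₀
            (s₀ • normalRep T u (metricRepr g hψ) (graphMap T u (horiz ψ T f y₀))) w') := by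
    intro w'
    have h := leviCivita_mpullback_chart g hψ (Y := fun p ↦ s₀ • normalRep T u (metricRepr g hψ) p)
      p₀ hYfd w'
    rw [mfderiv_inv hψ p₀] at h
    exact h
  -- the lift of `ν` is differentiable
  have hνlift : MDifferentiableAt (𝓡 2) (𝓡 3).tangent
      (fun y ↦ (TotalSpace.mk' E3 (f y) (ν y) : TangentBundle (𝓡 3) X)) y₀ :=
    (hν y₀).mdifferentiableAt (by simp)
  rw [PseudoRiemannianMetric.secondFundamentalForm_apply_holds (I' := 𝓡 2)
    BoundarylessManifold.isInteriorPoint hνlift v w, hD v,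
    mfderiv_apply_eq_graph hψ hW₀ hsrc hgr hy₀ hfd hux v,
    mfderiv_apply_eq_graph hψ hW₀ hsrc hgr hy₀ hfd hux w,
    val_congr_point g (apply_eq_symm_graphMap hsrc hgr hy₀),
    leviCivita_congr_point g (apply_eq_symm_graphMap hsrc hgr hy₀), hchart,
    val_symm_mfderiv_symm g hψ hz₀, fderiv_fun_const_smul hnRd, smul_apply,
    OpensChart.christoffel_smul, ← smul_add, map_smul, smul_apply, smul_eq_mul]
  congr 1
  -- identify the two ingredients with the symbols of the jet
  have hN : normalRep T u (metricRepr g hψ) (graphMap T u (horiz ψ T f y₀)) =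
      unitNormal T (metricRepr g hψ) (jetBaseOf u (horiz ψ T f y₀)) := by
    rw [normalRep, hTz]
  rw [hN, fderiv_normalRep_graphDiff hG' hpos hV hu hx₀V hz₀,
    OpensChart.christoffel_eq_chrAt (metric_val_eq_repr g hψ) p₀]
  rfl

/-- **The mean curvature of the surface is `∓Φ` of the jet**:
`H(y₀) = −s₀ Φ(jet2 u (φ y₀))`, by the trace formula `H = Σ (γ⁻¹)ⱼᵢ K(βᵢ, βⱼ)`
(`trace_eq_sum_gram_inv`) in the basis `βᵢ = dφ⁻¹ eᵢ`, where the Gram matrix is `γ̃` and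
`K(βᵢ, βⱼ) = s₀ K̃(eᵢ, eⱼ)`. This is `H₁ = Φ₁(Λ(µ))` of Fontenele–Silva 2001, Prop. 3.2 (`r = 1`)
for the chart inverse, with the normalisation and sign of `MinimalGraph.operator`.
[cite: FonteneleSilva2001, Prop. 3.2 (r = 1)] -/
theorem meanCurvature_eq [g.HasLeviCivita]
    (hψ : ψ ∈ IsManifold.maximalAtlas (𝓡 3) ∞ X) (hW₀ : IsOpen W₀)
    (hsrc : ∀ y ∈ W₀, f y ∈ ψ.source) (hgr : ∀ y ∈ W₀, (T (ψ (f y))).2 = u (T (ψ (f y))).1)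
    (hg : g.IsRiemannian) {V : Set (EuclideanSpace ℝ (Fin 2))} (hV : IsOpen V)
    (hu : ContDiffOn ℝ 2 u V) (hφV : ∀ y ∈ W₀, horiz ψ T f y ∈ V)
    (hpb : PseudoRiemannianMetric.contMDiff_pullbackBilin (𝓡 3) X (𝓡 2) S ∞)
    (hf : g.IsSpacelikeImmersion (𝓡 2) f) {ν : NormalField (𝓡 3) f}
    (hν : ContMDiff (𝓡 2) (𝓡 3).tangent ∞
      (fun y ↦ (TotalSpace.mk' E3 (f y) (ν y) : TangentBundle (𝓡 3) X)))
    {y₀ : S} (hy₀ : y₀ ∈ W₀) {s₀ : ℝ}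
    (hev : ∀ᶠ y in 𝓝 y₀,
      ν y = mpullback (𝓡 3) 𝓘(ℝ, E3) ψ (fun p ↦ s₀ • normalRep T u (metricRepr g hψ) p) (f y)) :
    g.meanCurvature f hpb hf ν y₀ =
      -(s₀ * operator T (metricRepr g hψ) (jet2 u (horiz ψ T f y₀))) := by
  have hux : DifferentiableAt ℝ u (horiz ψ T f y₀) :=
    (hu.differentiableOn two_ne_zero).differentiableAt (hV.mem_nhds (hφV y₀ hy₀))
  have hfc : ContMDiff (𝓡 2) (𝓡 3) ∞ f := hf.contMDiff_self
  have hfd : MDifferentiableAt (𝓡 2) (𝓡 3) f y₀ := hfc.mdifferentiableAt (by simp)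
  -- the basis `βᵢ = dφ⁻¹ eᵢ`
  have hbij := bijective_mfderiv_horiz hψ hW₀ hsrc hgr hy₀ hfd (hf.injective_mfderiv y₀) hux
  set L : EuclideanSpace ℝ (Fin 2) →L[ℝ] EuclideanSpace ℝ (Fin 2) :=
    mfderiv (𝓡 2) 𝓘(ℝ, EuclideanSpace ℝ (Fin 2)) (horiz ψ T f) y₀ with hLdef
  have hker : LinearMap.ker L.toLinearMap = ⊥ := LinearMap.ker_eq_bot.2 hbij.1
  have hrange : LinearMap.range L.toLinearMap = ⊤ := LinearMap.range_eq_top.2 hbij.2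
  set Le := ContinuousLinearEquiv.ofBijective L hker hrange with hLedef
  have hLe : ∀ a, mfderiv (𝓡 2) 𝓘(ℝ, EuclideanSpace ℝ (Fin 2)) (horiz ψ T f) y₀ (Le.symm a) = a :=
    fun a ↦ ContinuousLinearEquiv.ofBijective_apply_symm_apply L hker hrange a
  haveI : FiniteDimensional ℝ (TangentSpace (𝓡 2) y₀) :=
    inferInstanceAs (FiniteDimensional ℝ (EuclideanSpace ℝ (Fin 2)))
  set β : Module.Basis (Fin 2) ℝ (TangentSpace (𝓡 2) y₀) :=
    ((EuclideanSpace.basisFun (Fin 2) ℝ).toBasis).map Le.symm.toLinearEquiv with hβdef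
  have hβ : ∀ i, β i = Le.symm (stdVec i) := fun i ↦ by
    rw [hβdef, Module.Basis.map_apply, OrthonormalBasis.coe_toBasis, EuclideanSpace.basisFun_apply]
    rfl
  -- the trace formula
  unfold PseudoRiemannianMetric.meanCurvature
  rw [trace_eq_sum_gram_inv (g.inducedMetric f hpb hf) y₀ β]
  have hγ : (Matrix.of fun i j ↦ (g.inducedMetric f hpb hf).val y₀ (β i) (β j)) =
      gram T (metricRepr g hψ) (jetBaseOf u (horiz ψ T f y₀)) := by
    ext i j
    rw [Matrix.of_apply, PseudoRiemannianMetric.inducedMetric_val,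
      PseudoRiemannianMetric.inducedBilin_apply,
      val_mfderiv_mfderiv_eq_firstFF g hψ hW₀ hsrc hgr hy₀ hfd hux, hβ, hβ, hLe, hLe]
    rfl
  have hK : ∀ i j, g.secondFundamentalForm (𝓡 2) f ν y₀ (β i) (β j) =
      s₀ * sff T (metricRepr g hψ) (jet2 u (horiz ψ T f y₀)) (stdVec i) (stdVec j) := by
    intro i j
    rw [secondFundamentalForm_eq_sff g hψ hW₀ hsrc hgr hg hV hu hφV hfc hν hy₀ hev, hβ, hβ, hLe, hLe]
  simp_rw [hK]
  rw [hγ]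
  simp only [operator, jet2_snd, mul_neg, neg_neg, Finset.mul_sum]
  exact Finset.sum_congr rfl fun i _ ↦ Finset.sum_congr rfl fun j _ ↦ by ring

end Chart

end MinimalGraphHolds

/-! ### The minimal-graph operator of a chart and the discharges -/

open MinimalGraph AtlasChart MinimalGraphHolds PseudoRiemannianMetric in
/-- **The minimal-graph operator of a chart of the maximal atlas** (step (2) of the tangency
principle, Fontenele–Silva 2001, Lemma 3.1 and Props. 3.2, 3.4, for the chart `T ∘ ψ` of the
Riemannian `3`-manifold `(X, h)`): `Φ = MinimalGraph.operator T G'` on the components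
`G' = AtlasChart.metricRepr (ofRiemannian h) hψ` of the metric in the chart — `C¹` and elliptic on
the jets based in the chart (`contDiffOn_operator`, `isEllipticAt_operator`), and vanishing on the
jet of every `C²` function whose graph is an open piece of a smoothly embedded minimal surface:
over `x ∈ V` pick `y₀ ∈ W₀`; by `exists_sign_eventually_eq` the unit normal is `ψ^*(±N) ∘ f` near
`y₀`, so `H(y₀) = ∓Φ(jet2 u x)` (`meanCurvature_eq`), and `H = 0`.
[cite: FonteneleSilva2001, Lemma 3.1, Prop. 3.2 and Prop. 3.4 (r = 1)] -/
def minimalGraphOperator {X : Type} [TopologicalSpace X] [ChartedSpace E3 X]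
    [IsManifold (𝓡 3) ∞ X]
    (h : ContMDiffRiemannianMetric (𝓡 3) ∞ E3 (TangentSpace (𝓡 3) : X → Type _))
    [(ofRiemannian h).HasLeviCivita] (ψ : OpenPartialHomeomorph X E3)
    (T : E3 ≃L[ℝ] EuclideanSpace ℝ (Fin 2) × ℝ) (hψ : ψ ∈ IsManifold.maximalAtlas (𝓡 3) ∞ X) :
    MinimalGraphOperator h ψ T where
  Φ := operator T (metricRepr (ofRiemannian h) hψ)
  contDiffOn :=
    (contDiffOn_operator (isMetricOn_metricRepr (ofRiemannian h) hψ)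
      (metricRepr_pos (ofRiemannian h) hψ (isRiemannian_ofRiemannian h))).of_le
      (by exact_mod_cast le_top)
  isEllipticAt := fun p hp ↦
    isEllipticAt_operator (isMetricOn_metricRepr (ofRiemannian h) hψ)
      (metricRepr_pos (ofRiemannian h) hψ (isRiemannian_ofRiemannian h)) hp
  eq_zero := by
    intro S _ _ _ _ f ν hpb hf hemb hunit hν hmin W₀ V u hW₀ hV hu hsrc hφV hgr x hx
    have hφV' : ∀ y ∈ W₀, horiz ψ T f y ∈ V := fun y hy ↦ by
      rw [← hφV]
      exact mem_image_of_mem _ hy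
    obtain ⟨y₀, hy₀, rfl⟩ : ∃ y₀ ∈ W₀, horiz ψ T f y₀ = x := by
      rw [← hφV] at hx
      obtain ⟨y₀, hy₀, hx₀⟩ := hx
      exact ⟨y₀, hy₀, hx₀⟩
    obtain ⟨s₀, hs₀, hev⟩ := exists_sign_eventually_eq (ofRiemannian h) hψ hW₀ hsrc hgr
      (isRiemannian_ofRiemannian h) hV hu hφV' hf.contMDiff_self hf.injective_mfderiv hunit hν hy₀
    have hH := meanCurvature_eq (ofRiemannian h) hψ hW₀ hsrc hgr (isRiemannian_ofRiemannian h)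
      hV hu hφV' hpb hf hν hy₀ hev
    rw [hmin y₀] at hH
    have hs : s₀ ≠ 0 := by
      rcases hs₀ with h0 | h0 <;> rw [h0] <;> norm_num
    have h0 : s₀ * operator T (metricRepr (ofRiemannian h) hψ) (jet2 u (horiz ψ T f y₀)) = 0 := by
      linarith
    exact (mul_eq_zero.1 h0).resolve_left hs

/-- **Discharge of `minimalGraph_strongMaximumPrinciple`** (Andersson–Galloway–Howard 1998,
Thm. 3.10 for two minimal graphs): the reduction
`minimalGraph_strongMaximumPrinciple_of_minimalGraphOperator` of `TangencyMaximumPrinciple.lean`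
(Alexandrov's maximum principle, proved there, plus the clopen argument of
`MinimalSurfaceTangency.lean`) fed with the minimal-graph operators `minimalGraphOperator` of
all charts. [cite: AnderssonGallowayHoward1998, Thm. 3.10 (case H₀ = 0)] -/
theorem minimalGraph_strongMaximumPrinciple_holds : minimalGraph_strongMaximumPrinciple :=
  minimalGraph_strongMaximumPrinciple_of_minimalGraphOperator
    fun _ _ _ _ _ _ h _ ψ T hψ ↦ ⟨minimalGraphOperator h ψ T hψ⟩

/-- **Discharge of the barrier principle for minimal surfaces** (`minimalSurface_barrierPrinciple`
of `MinimalSurfaceBarrier.lean`): `minimalSurface_barrierPrinciple_of_graph` with both of its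
inputs now proved. [cite: AnderssonGallowayHoward1998, Thm. 3.10] -/
theorem minimalSurface_barrierPrinciple_holds : minimalSurface_barrierPrinciple :=
  minimalSurface_barrierPrinciple_of_graph minimalGraph_strongMaximumPrinciple_holds
    touchingSurface_locallyGraph_holds

/-- **Discharge of the boundary maximum principle for minimal surfaces**
(`minimalSurface_boundary_maximumPrinciple` of `ExteriorRegion.lean`):
`minimalSurface_boundary_maximumPrinciple_of_graph` with both of its inputs now proved.
[cite: AnderssonGallowayHoward1998, Thm. 3.10] -/
theorem minimalSurface_boundary_maximumPrinciple_holds : minimalSurface_boundary_maximumPrinciple :=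
  minimalSurface_boundary_maximumPrinciple_of_graph minimalGraph_strongMaximumPrinciple_holds
    touchingSurface_locallyGraph_holds

end Literature.Geometry.Lorentzian

end
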